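import Summits.BirchSwinnertonDyer.BirchSwinnertonDyer.Theorems.GenusKolyvaginAtTwoPowDvdShaCardAtTwoRTExactSwapCore
import HarnessLib

/-!
# Route `GenusKolyvaginAtTwo`, LINE 18 (L_T `PowDvdShaCardAtTwoRT`, stmt-BirchSwinnertonDyer-23242), stub KS — THE EXACT PRIME SWAP AT 2, core form
# WITH THE FROBENIUS BINDER ON THE SWAPPED-OUT PRIME (gk2-p3 g23's correction of the P7b⁼ socket)

LEAD seat `bsd-line-gk2-p1` g18 (cell `bsd-f1-sign2`), `--supports stmt-BirchSwinnertonDyer-23242` (helper; closes nothing).  THEOREMS ONLY;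
BSD is not proved by any of this; neither is the crux, nor stub KS.  Twin of `exactSwap_core` (`…RTExactSwapCore`, p727522).

WHY.  gk2-p3 g23 (STATUS 15:13Z): the sharp upper bound P7b⁼ («`2^(a₀+b₀−M−1) • ⟨w, C⟩_v = 0`») displayed by `exactSwap_core` WITHOUT a
Frobenius condition on the swapped-out prime `q` is FALSE in general — at a Zhang–Kolyvagin prime with `Frob_q = diag(1,−1)` on `E[2^(M+1)]` the
`unr_s × tr_s` pairing loses no bit; the lost bit needs the REGULAR eigenlines, i.e. `FrobEqFrobInfty W K (2^M′) q` (`M ≤ M′`), exactly as P7a⁼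
already carries for the fresh prime.  `exactSwap_core_frob` is `exactSwap_core` VERBATIM with (i) that binder added to `hP7b`
(`… → M + 1 ≤ index q → M ≤ M′ → FrobEqFrobInfty W K (2^M′) q → q ∈ v → …`, gk2-p3's text) and (ii) the matching input
`haF : FrobEqFrobInfty W K (2^(M+k)) a` on the prime being swapped out — available in the KS assembly, whose admissible class is
«Zhang–Kolyvagin ∧ index ≥ L+k ∧ FrobEqFrobInfty W K (2^(L+k))» (gk2-p2 g19 / gk2-p5 g24 `hbot_socket_margin`, `hK_socket_margin`; the swap's
own output primes carry it).  Everything else — the exact deep pair Čebotarev with (NPh) separation, signs, data triple, P6, Q2 at `ℓ` and at `a`,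
the equal-exponent contradiction `u + g − 2 − M` — is unchanged; the two dictionaries of `…RTExactSwapCore` are reused.
References: [McCallumLMS1991] §5 Prop. 5.2 (proof, pp. 308–310), Lemma 5.3, Prop. 4.4; [Kolyvagin1991MathAnn] §2 Thm. 2.2; [GrossLMS1991] Prop. 3.7, 6.2.
-/

set_option autoImplicit false
set_option linter.dupNamespace false

noncomputable section

open scoped Classical Pointwise
open Function NumberField IsDedekindDomain WeierstrassCurve Field
open Literature.NumberTheory.EllipticCurves Literature.NumberTheory.GaloisRepresentations
open Literature.NumberTheory.EllipticCurves.Jetchev2008 Literature.NumberTheory.EllipticCurves.ModularForms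
open Literature.NumberTheory.GaloisCohomology
open Literature.NumberTheory.GaloisRepresentations.DiscreteGaloisModule (localTatePairingZMod
  tateDual SelmerStructure)
open Summit.BirchSwinnertonDyer.Rank1Residual.JET.SelmerVocabulary
open Summit.BirchSwinnertonDyer.Rank1Residual.JET.GlobalDuality
open Summit.BirchSwinnertonDyer.BirchSwinnertonDyer.Theses.GenusKolyvaginAtTwo (KolyvaginRelationAtTwo)
open Summit.BirchSwinnertonDyer.BirchSwinnertonDyer.Theorems.KolyvaginLowerBoundAtTwo

namespace Summit.BirchSwinnertonDyer.BirchSwinnertonDyer.Theorems.GenusExact.PlusDescent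

section Frame

variable {K : Type} [Field K] [NumberField K] (W : WeierstrassCurve ℚ) [W.IsElliptic]
  [W.IsGloballyMinimal] [(W.baseChange K).IsElliptic] [NeZero (W.conductorNorm ℤ)]
  [∀ M : ℕ, NeZero (2 ^ M)] [∀ M : ℕ, Finite (geomTorsion (W.baseChange K) ((2 ^ M : ℕ) : ℤ))]
  (τ : K ≃ₐ[ℚ] K)
  (Dt : ModularParametrizationData W (W.conductorNorm ℤ)) (β : ℤ) (ι : K →+* ℂ)
  (e : ∀ M : ℕ, geomTorsion (W.baseChange K) ((2 ^ M : ℕ) : ℤ) →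
    geomTorsion (W.baseChange K) ((2 ^ M : ℕ) : ℤ) → AlgebraicClosure K)
  (hμ : ∀ M S T, e M S T ^ (2 ^ M) = 1)
  (hadd₁ : ∀ M S₁ S₂ T, e M (S₁ + S₂) T = e M S₁ T * e M S₂ T)
  (hadd₂ : ∀ M S T₁ T₂, e M S (T₁ + T₂) = e M S T₁ * e M S T₂)
  (hgal : ∀ M (g : absoluteGaloisGroup K) (S T : geomTorsion (W.baseChange K) ((2 ^ M : ℕ) : ℤ)),
    g • e M S T = e M (g • S) (g • T))
  (halt : ∀ M T, e M T T = 1) (hnondeg : ∀ M T, (∀ S, e M S T = 1) → T = 0)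
  (inv : ∀ M : ℕ, LocalInvariants K (2 ^ M))
  (𝒯 : ∀ M : ℕ, SelmerStructure ((W.baseChange K).torsionGaloisModule ((2 ^ M : ℕ) : ℤ)))
  (hCM : ¬ W.HasCM) (hΔ : W.Δ < 0)
  (hsur : ∀ m : ℕ, W.HasSurjectiveModNGaloisRep (2 ^ m : ℕ)) (hK : IsImaginaryQuadratic K)
  (hodd : Odd (NumberField.discr K)) (hne3 : NumberField.discr K ≠ -3)
  (hns : ¬ IsSquare ((NumberField.discr K : ℚ) * -|W.Δ|))
  (hHN : SatisfiesHeegnerHypothesis (W.conductorNorm ℤ) K)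
  (hτ1 : τ ≠ 1)
  (hperf : ∀ M, (inv M).IsPerfect) (hvan : ∀ M, (inv M).SumLocalTermEqZero)
  (h𝒯sd : ∀ (M c : ℕ), ∀ v ∈ placesDividing K c,
    (inv M).dualTransported (𝒯 M) (weilDualIntertwining (W.baseChange K) (2 ^ M) (e M) (hμ M) (hadd₁ M)
      (hadd₂ M) (hgal M)) (Sum.inr v) = 𝒯 M (Sum.inr v))
  (hP4 : ∀ (M c : ℕ) (dat : KolyvaginHeegnerData Dt β ι c),
    KolyvaginDescent.KolSupp (Zhang2014.IsKolyvaginPrime (W.conductorNorm ℤ) W K 2) c → 1 ≤ M →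
    (∀ q ∈ c.primeFactors, M + 1 ≤ Zhang2014.kolyvaginIndex W 2 q) →
    ∀ w ∈ placesDividing K c,
      galoisCohomology.localization ((W.baseChange K).torsionGaloisModule ((2 ^ M : ℕ) : ℤ)) (Sum.inr w) 1
        (dat.kolyvaginClass Nat.prime_two M) ∈ 𝒯 M (Sum.inr w))
  (hP5 : ∀ (M m a : ℕ) (v₀ : HeightOneSpectrum (𝓞 K)) (s : ℤ), (s = 1 ∨ s = -1) → 9 ≤ M →
    KolyvaginDescent.KolSupp (Zhang2014.IsKolyvaginPrime (W.conductorNorm ℤ) W K 2) m →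
    (∀ q ∈ m.primeFactors, M + 1 ≤ Zhang2014.kolyvaginIndex W 2 q) →
    Zhang2014.IsKolyvaginPrime (W.conductorNorm ℤ) W K 2 a → M + 1 ≤ Zhang2014.kolyvaginIndex W 2 a →
    ¬ a ∣ m → ((a : ℕ) : 𝓞 K) ∈ v₀.asIdeal →
    ∃ w : galoisCohomology ((W.baseChange K).torsionGaloisModule ((2 ^ M : ℕ) : ℤ)) 1,
      w ∈ signPart W K τ ((2 ^ M : ℕ) : ℤ) s
        (((selmerF W ((2 ^ M : ℕ) : ℤ) (𝒯 M) (placesDividing K m)).relaxedAt {v₀}).selmerGroup) ∧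
      ((2 ^ (M / 2 - 5) : ℕ) : ℤ) • w ≠ 0)
  (hP7a : ∀ (M M' ℓ : ℕ) (v : HeightOneSpectrum (𝓞 K))
    (w C : galoisCohomology ((W.baseChange K).torsionGaloisModule ((2 ^ M : ℕ) : ℤ)) 1) (s : ℤ) (a b : ℕ),
    (s = 1 ∨ s = -1) → Zhang2014.IsKolyvaginPrime (W.conductorNorm ℤ) W K 2 ℓ →
    M ≤ Zhang2014.kolyvaginIndex W 2 ℓ → M ≤ M' → FrobEqFrobInfty W K (2 ^ M') ℓ →
    ((ℓ : ℕ) : 𝓞 K) ∈ v.asIdeal →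
    conjAct W τ ((2 ^ M : ℕ) : ℤ) w = s • w → conjAct W τ ((2 ^ M : ℕ) : ℤ) C = s • C →
    galoisCohomology.localization ((W.baseChange K).torsionGaloisModule ((2 ^ M : ℕ) : ℤ)) (Sum.inr v) 1 w ∈
      (W.baseChange K).kummerSelmerStructure ((2 ^ M : ℕ) : ℤ) (Sum.inr v) →
    ((2 ^ a : ℕ) : ℤ) • galoisCohomology.localization ((W.baseChange K).torsionGaloisModule ((2 ^ M : ℕ) : ℤ))
      (Sum.inr v) 1 w ≠ 0 →
    ((2 ^ b : ℕ) : ℤ) • galoisCohomology.localization ((W.baseChange K).torsionGaloisModule ((2 ^ M : ℕ) : ℤ))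
      (Sum.inr v) 1 C ∉ (W.baseChange K).kummerSelmerStructure ((2 ^ M : ℕ) : ℤ) (Sum.inr v) →
    M ≤ a + b →
    (2 ^ (a + b - M) : ℕ) •
        localTatePairingZMod ((W.baseChange K).torsionGaloisModule ((2 ^ M : ℕ) : ℤ)) (2 ^ M) (Sum.inr v)
          (inv M (Sum.inr v))
          (galoisCohomology.localization ((W.baseChange K).torsionGaloisModule ((2 ^ M : ℕ) : ℤ)) (Sum.inr v) 1 w)
          (galoisCohomology.localization (((W.baseChange K).torsionGaloisModule ((2 ^ M : ℕ) : ℤ)).tateDual (2 ^ M))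
            (Sum.inr v) 1
            (galoisCohomology.map (weilDualIntertwining (W.baseChange K) (2 ^ M) (e M) (hμ M) (hadd₁ M) (hadd₂ M)
              (hgal M)) 1 C)) ≠ 0)
  (hP7b : ∀ (M M' q : ℕ) (v : HeightOneSpectrum (𝓞 K))
    (w C : galoisCohomology ((W.baseChange K).torsionGaloisModule ((2 ^ M : ℕ) : ℤ)) 1) (s : ℤ) (a₀ b₀ : ℕ),
    (s = 1 ∨ s = -1) → Zhang2014.IsKolyvaginPrime (W.conductorNorm ℤ) W K 2 q →
    M + 1 ≤ Zhang2014.kolyvaginIndex W 2 q → M ≤ M' → FrobEqFrobInfty W K (2 ^ M') q → ((q : ℕ) : 𝓞 K) ∈ v.asIdeal →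
    conjAct W τ ((2 ^ M : ℕ) : ℤ) w = s • w → conjAct W τ ((2 ^ M : ℕ) : ℤ) C = s • C →
    galoisCohomology.localization ((W.baseChange K).torsionGaloisModule ((2 ^ M : ℕ) : ℤ)) (Sum.inr v) 1 C ∈
      𝒯 M (Sum.inr v) →
    ((2 ^ a₀ : ℕ) : ℤ) • galoisCohomology.localization ((W.baseChange K).torsionGaloisModule ((2 ^ M : ℕ) : ℤ))
      (Sum.inr v) 1 w ∈ 𝒯 M (Sum.inr v) →
    ((2 ^ b₀ : ℕ) : ℤ) • galoisCohomology.localization ((W.baseChange K).torsionGaloisModule ((2 ^ M : ℕ) : ℤ))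
      (Sum.inr v) 1 C = 0 →
    (2 ^ (a₀ + b₀ - M - 1) : ℕ) •
        localTatePairingZMod ((W.baseChange K).torsionGaloisModule ((2 ^ M : ℕ) : ℤ)) (2 ^ M) (Sum.inr v)
          (inv M (Sum.inr v))
          (galoisCohomology.localization ((W.baseChange K).torsionGaloisModule ((2 ^ M : ℕ) : ℤ)) (Sum.inr v) 1 w)
          (galoisCohomology.localization (((W.baseChange K).torsionGaloisModule ((2 ^ M : ℕ) : ℤ)).tateDual (2 ^ M))
            (Sum.inr v) 1
            (galoisCohomology.map (weilDualIntertwining (W.baseChange K) (2 ^ M) (e M) (hμ M) (hadd₁ M) (hadd₂ M)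
              (hgal M)) 1 C)) = 0)
  (hQ2 : KolyvaginRelationAtTwo)
  (hT2 : ∀ (n : ℕ) (d : KolyvaginHeegnerData Dt β ι n) (M : ℕ),
    KolyvaginDescent.KolSupp (Zhang2014.IsKolyvaginPrime (W.conductorNorm ℤ) W K 2) n →
    1 ≤ M → (M : ℕ∞) ≤ Zhang2014.levelIndex W 2 n →
    ∀ v : HeightOneSpectrum (𝓞 K), ((n : ℕ) : 𝓞 K) ∉ v.asIdeal →
      ((2 ^ 0 : ℕ) : ℤ) • d.kolyvaginClass Nat.prime_two M ∈
        selmerLocalKer (W.baseChange K) (v.adicCompletion K) ((2 ^ M : ℕ) : ℤ))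

include halt hnondeg hCM hΔ hsur hK hodd hne3 hns hHN hτ1 hperf hvan h𝒯sd hP4 hP5 hP7a hP7b hQ2 hT2 in
/-- **THE EXACT PRIME SWAP AT `2` (McCallum Prop. 5.2, proof step), core form, Frobenius binder on the swapped-out prime.**  From a square-free product `n` of Kolyvagin primes of
index `≥ M+1`, `a ∣ n`, a datum at `n` whose class `c_M(n)` has EXACT order `2^g` (`g ≥ 1`), room `M + 6 ≤ M/2 + g` (`12 ≤ M`), extra depth
`k ≥ 1` and (NPh) at level `2^(M+k)` (robust `2N`-form): a fresh Kolyvagin prime `ℓ ∉ X`, `ℓ ∤ n`, of index `≥ M+k` with `Frob_ℓ = Frob_∞` on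
`K(E[2^(M+k)])`, at whose places `2^(g−1) c_M(n)` is locally non-zero, and a datum at `n/a·ℓ` with **`2^(g−1) • c_M(n/a·ℓ) ≠ 0`** (no loss).
[cite: McCallumLMS1991, §5 Prop. 5.2 (proof), Lemma 5.3, Prop. 4.4] [cite: Kolyvagin1991MathAnn, §2 Thm. 2.2] -/
theorem exactSwap_core_frob {M k g n a : ℕ} (X : Finset ℕ) (dat : KolyvaginHeegnerData Dt β ι n)
    (hM : 12 ≤ M) (hk : 1 ≤ k) (hn : Squarefree n)
    (hnK : ∀ p ∈ n.primeFactors, Zhang2014.IsKolyvaginPrime (W.conductorNorm ℤ) W K 2 p ∧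
      M + 1 ≤ Zhang2014.kolyvaginIndex W 2 p)
    (ha : a ∈ n.primeFactors) (haF : FrobEqFrobInfty W K (2 ^ (M + k)) a)
    (hg : 1 ≤ g) (hord : addOrderOf (dat.kolyvaginClass Nat.prime_two M) = 2 ^ g)
    (hroom : M + 6 ≤ M / 2 + g)
    (hNPh : ∀ z : galH1Torsion (W.baseChange K) ((2 ^ (M + k) : ℕ) : ℤ),
      (∀ ρ ∈ torsionFixing (W.baseChange K) ((2 ^ (M + k) : ℕ) : ℤ),
        h1Eval (W.baseChange K) ((2 ^ (M + k) : ℕ) : ℤ) z ρ = 0) →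
      (∀ w : HeightOneSpectrum (𝓞 K), ((2 * W.conductorNorm ℤ : ℕ) : 𝓞 K) ∈ w.asIdeal →
        z ∈ selmerLocalKer (W.baseChange K) (w.adicCompletion K) ((2 ^ (M + k) : ℕ) : ℤ)) → z = 0) :
    ∃ ℓ : ℕ, ℓ ∉ X ∧ ℓ ∉ n.primeFactors ∧ Zhang2014.IsKolyvaginPrime (W.conductorNorm ℤ) W K 2 ℓ ∧
      M + k ≤ Zhang2014.kolyvaginIndex W 2 ℓ ∧ FrobEqFrobInfty W K (2 ^ (M + k)) ℓ ∧
      (∀ v : HeightOneSpectrum (𝓞 K), ((ℓ : ℕ) : 𝓞 K) ∈ v.asIdeal →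
        ((2 ^ (g - 1) : ℕ) : ℤ) • dat.kolyvaginClass Nat.prime_two M ∉
          (W.baseChange K).torsionLocalKer (v.adicCompletion K) ((2 ^ M : ℕ) : ℤ)) ∧
      ∃ dat' : KolyvaginHeegnerData Dt β ι (n / a * ℓ),
        ((2 ^ (g - 1) : ℕ) : ℤ) • dat'.kolyvaginClass Nat.prime_two M ≠ 0 := by
  classical
  haveI : Fact (Nat.Prime 2) := ⟨Nat.prime_two⟩
  have hM1 : 1 ≤ M := by omega
  have hne4 : NumberField.discr K ≠ -4 := fun h ↦ by
    rw [h] at hodd; have := Int.odd_iff.mp hodd; omega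
  have hρ2 : W.HasSurjectiveModNGaloisRep 2 := by simpa using hsur 1
  have hsur1 : W.HasSurjectiveModNGaloisRep ((2 : ℤ) ^ 1) := by exact_mod_cast hsur 1
  have hn0 : n ≠ 0 := hn.ne_zero
  have hap : a.Prime := Nat.prime_of_mem_primeFactors ha
  have han : a ∣ n := Nat.dvd_of_mem_primeFactors ha
  have hKola : Zhang2014.IsKolyvaginPrime (W.conductorNorm ℤ) W K 2 a := (hnK a ha).1
  have hidxa : M + 1 ≤ Zhang2014.kolyvaginIndex W 2 a := (hnK a ha).2
  have hnKol : KolyvaginDescent.KolSupp (Zhang2014.IsKolyvaginPrime (W.conductorNorm ℤ) W K 2) n :=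
    ⟨hn, fun q hq ↦ (hnK q hq).1⟩
  have hnK' : ∀ p ∈ n.primeFactors, Zhang2014.IsKolyvaginPrime (W.conductorNorm ℤ) W K 2 p ∧
      M ≤ Zhang2014.kolyvaginIndex W 2 p := fun p hp ↦ ⟨(hnK p hp).1, Nat.le_of_succ_le (hnK p hp).2⟩
  have hnlev : (M : ℕ∞) ≤ Zhang2014.levelIndex W 2 n :=
    Zhang2014.natCast_le_levelIndex_iff.mpr fun q hq ↦ Nat.le_of_succ_le (hnK q hq).2
  have hmn : n / a ∣ n := Nat.div_dvd_of_dvd han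
  have hm : Squarefree (n / a) := hn.squarefree_of_dvd hmn
  have hm0 : n / a ≠ 0 := hm.ne_zero
  have hmpf : ∀ q ∈ (n / a).primeFactors, q ∈ n.primeFactors :=
    fun q hq ↦ Nat.primeFactors_mono hmn hn0 hq
  have ham : a ∉ (n / a).primeFactors := by
    intro h
    have hdvd₂ : a * a ∣ n := by
      have := Nat.mul_dvd_mul_left a (Nat.dvd_of_mem_primeFactors h)
      rwa [Nat.mul_div_cancel' han] at this
    exact hap.one_lt.ne' (Nat.isUnit_iff.mp (hn a hdvd₂))
  have hadvm : ¬ a ∣ n / a := fun h ↦ ham (Nat.mem_primeFactors.mpr ⟨hap, h, hm0⟩)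
  have hmKol : KolyvaginDescent.KolSupp (Zhang2014.IsKolyvaginPrime (W.conductorNorm ℤ) W K 2) (n / a) :=
    ⟨hm, fun q hq ↦ (hnK q (hmpf q hq)).1⟩
  have hmidx : ∀ q ∈ (n / a).primeFactors, M + 1 ≤ Zhang2014.kolyvaginIndex W 2 q :=
    fun q hq ↦ (hnK q (hmpf q hq)).2
  have hcopK : ∀ q : ℕ, Zhang2014.IsKolyvaginPrime (W.conductorNorm ℤ) W K 2 q → ¬ q ∣ 2 * W.conductorNorm ℤ :=
    fun q hq hdvd ↦ ((Nat.Prime.dvd_mul hq.1).mp hdvd).elim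
      (fun h2 ↦ hq.2.2.2.1 ((Nat.prime_dvd_prime_iff_eq hq.1 Nat.prime_two).mp h2)) fun hN ↦ hq.2.1 hN
  have hcop : ∀ m' : ℕ, m' ≠ 0 → (∀ q ∈ m'.primeFactors, Zhang2014.IsKolyvaginPrime (W.conductorNorm ℤ) W K 2 q) →
      Nat.Coprime m' (2 * W.conductorNorm ℤ) := fun m' hm'0 hm' ↦
    Nat.coprime_of_dvd fun q hq hqm hqN ↦ hcopK q (hm' q (Nat.mem_primeFactors.mpr ⟨hq, hqm, hm'0⟩)) hqN
  obtain ⟨v₀, hv₀⟩ : ∃ v : HeightOneSpectrum (𝓞 K), ((a : ℕ) : 𝓞 K) ∈ v.asIdeal :=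
    ⟨⟨Ideal.span {((a : ℕ) : 𝓞 K)}, hKola.2.2.2.2.1, by
        rw [Ne, Ideal.span_singleton_eq_bot]; exact_mod_cast hap.ne_zero⟩,
      Ideal.mem_span_singleton_self _⟩
  set c := dat.kolyvaginClass Nat.prime_two M with hc_def
  have hMc : ((2 ^ M : ℕ) : ℤ) • c = 0 := zsmul_galH1Torsion_eq_zero _ _ _
  have hgc : ((2 ^ g : ℕ) : ℤ) • c = 0 := by
    rw [natCast_zsmul, ← hord]; exact addOrderOf_nsmul_eq_zero c
  have hjc : ((2 ^ (g - 1) : ℕ) : ℤ) • c ≠ 0 := fun h ↦ by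
    have hdvd := addOrderOf_dvd_of_nsmul_eq_zero ((natCast_zsmul c (2 ^ (g - 1))).symm.trans h)
    rw [hord, Nat.pow_dvd_pow_iff_le_right (by norm_num)] at hdvd; omega
  have hc0 : c ≠ 0 := fun h ↦ hjc (by rw [h, zsmul_zero])
  have hgM : g ≤ M := by
    by_contra h
    apply hjc
    exact two_pow_zsmul_eq_zero_of_le_swap (by omega) hMc
  obtain ⟨hεn, hcsign⟩ := KolyvaginClassSign.sign_conjAct_kolyvaginClass_two hK hne3 hne4 hodd hHN hsur1 τ hτ1
    Dt β ι hn hM1 hnK' dat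
  set εn : ℤ := -W.rootNumber * (-1) ^ n.primeFactors.card with hεn_def
  set ε' : ℤ := -εn with hε'_def
  have hε' : ε' = 1 ∨ ε' = -1 := by
    rcases hεn with h | h
    · exact Or.inr (by rw [hε'_def, h])
    · exact Or.inl (by rw [hε'_def, h]; norm_num)
  obtain ⟨w, hwsign, hword⟩ := hP5 M (n / a) a v₀ ε' hε' (by omega) hmKol hmidx hKola hidxa hadvm hv₀
  obtain ⟨hwF, hwτ⟩ := (mem_signPart_iff W K τ _ _ _ w).mp hwsign
  have hMw : ((2 ^ M : ℕ) : ℤ) • w = 0 := zsmul_galH1Torsion_eq_zero (W.baseChange K) _ w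
  obtain ⟨u, hru, huM, hu0, hu1⟩ := exists_two_pow_orderExp_swap w hMw hword
  have hu_one : 1 ≤ u := by omega
  have hwu : addOrderOf w = 2 ^ u := addOrderOf_eq_two_pow_of_zsmul_swap hu_one hu0 hu1
  have hw0 : w ≠ 0 := fun h ↦ hword (by rw [h, zsmul_zero])
  have hcSel : ∀ w' : HeightOneSpectrum (𝓞 K), ((2 * W.conductorNorm ℤ : ℕ) : 𝓞 K) ∈ w'.asIdeal →
      c ∈ selmerLocalKer (W.baseChange K) (w'.adicCompletion K) ((2 ^ M : ℕ) : ℤ) := by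
    intro w' hw'
    have hnw' : ((n : ℕ) : 𝓞 K) ∉ w'.asIdeal :=
      natCast_notMem_of_coprime_swap (hcop n hn0 fun q hq ↦ (hnK q hq).1) w' hw'
    have h := hT2 n dat M hnKol hM1 hnlev w' hnw'
    rwa [pow_zero, Nat.cast_one, one_zsmul] at h
  have hwSel : ∀ w' : HeightOneSpectrum (𝓞 K), ((2 * W.conductorNorm ℤ : ℕ) : 𝓞 K) ∈ w'.asIdeal →
      w ∈ selmerLocalKer (W.baseChange K) (w'.adicCompletion K) ((2 ^ M : ℕ) : ℤ) := by
    intro w' hw'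
    have hmw' : ((n / a : ℕ) : 𝓞 K) ∉ w'.asIdeal :=
      natCast_notMem_of_coprime_swap (hcop (n / a) hm0 fun q hq ↦ (hnK q (hmpf q hq)).1) w' hw'
    have haw' : ((a : ℕ) : 𝓞 K) ∉ w'.asIdeal :=
      natCast_notMem_of_coprime_swap (hcop a hap.ne_zero fun q hq ↦ by
        rw [hap.primeFactors, Finset.mem_singleton] at hq; rw [hq]; exact hKola) w' hw'
    have hw'm : w' ∉ placesDividing K (n / a) := fun h ↦
      hmw' ((mem_placesDividing_iff_natCast_mem hm0 w').mp h)
    have hw'v₀ : w' ≠ v₀ := fun h ↦ haw' (h ▸ hv₀)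
    have h := (SelmerStructure.mem_selmerGroup_iff _ w).mp hwF (Sum.inr w')
    rw [relaxedAt_inr_of_ne W _ _ hw'v₀, selmerF_inr, if_neg hw'm] at h
    exact (mem_selmerLocalKer_two_pow_iff W M w' w).mpr h
  have hdvd := natCast_pow_dvd_natCast_pow_add 2 M k
  have hιinj : Function.Injective (torsionH1OfDvd (W.baseChange K) hdvd) :=
    torsionH1OfDvd_two_pow_injective W K hK hρ2 M k
  have hinf := infinite_kolyvaginPrime_localization_fullOrder_pair_deep W K hCM hΔ hK hns hsur τ hτ1 M k hM1 c w
    hg hu_one hord hwu hεn hε' hcsign hwτ (fun a' b' hab ↦ by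
      have hz := hNPh _ hab fun w' hw' ↦
        (RelaxedCount.torsionH1OfDvd_mem_selmerLocalKer_iff_mem (W.baseChange K) hdvd (w'.adicCompletion K) _).mpr
          (add_mem (AddSubgroup.zsmul_mem _ (hcSel w' hw') a') (AddSubgroup.zsmul_mem _ (hwSel w' hw') b'))
      exact hιinj (by rw [hz, map_zero]))
  obtain ⟨ℓ, hℓmem, hℓE⟩ := hinf.exists_notMem_finset (X ∪ n.primeFactors)
  obtain ⟨hfrob, hKolℓ, hIℓ, hlocℓ⟩ := hℓmem
  rw [Finset.mem_union, not_or] at hℓE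
  obtain ⟨hℓX, hℓn⟩ := hℓE
  have hℓp : ℓ.Prime := hKolℓ.1
  have hℓ0 : ℓ ≠ 0 := hℓp.ne_zero
  have hℓdvd : ¬ ℓ ∣ n := fun h ↦ hℓn (Nat.mem_primeFactors.mpr ⟨hℓp, h, hn0⟩)
  have hMℓ : M ≤ Zhang2014.kolyvaginIndex W 2 ℓ := le_trans (by omega) hIℓ
  have hM1ℓ : M + 1 ≤ Zhang2014.kolyvaginIndex W 2 ℓ := le_trans (by omega) hIℓ
  obtain ⟨v', hv'⟩ : ∃ v : HeightOneSpectrum (𝓞 K), ((ℓ : ℕ) : 𝓞 K) ∈ v.asIdeal :=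
    ⟨⟨Ideal.span {((ℓ : ℕ) : 𝓞 K)}, hKolℓ.2.2.2.2.1, by
        rw [Ne, Ideal.span_singleton_eq_bot]; exact_mod_cast hℓp.ne_zero⟩,
      Ideal.mem_span_singleton_self _⟩
  obtain ⟨hcloc, hwloc⟩ := hlocℓ v' hv'
  have hN : Squarefree (n * ℓ) :=
    (Nat.squarefree_mul ((Nat.Prime.coprime_iff_not_dvd hℓp).mpr hℓdvd).symm).mpr ⟨hn, hℓp.squarefree⟩
  have hN0 : n * ℓ ≠ 0 := hN.ne_zero
  have hNpf : (n * ℓ).primeFactors = n.primeFactors ∪ {ℓ} := by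
    rw [Nat.primeFactors_mul hn0 hℓ0, hℓp.primeFactors]
  have hNK : ∀ q ∈ (n * ℓ).primeFactors, Zhang2014.IsKolyvaginPrime (W.conductorNorm ℤ) W K 2 q ∧
      M + 1 ≤ Zhang2014.kolyvaginIndex W 2 q := by
    intro q hq
    rw [hNpf, Finset.mem_union, Finset.mem_singleton] at hq
    rcases hq with hq | rfl
    · exact hnK q hq
    · exact ⟨hKolℓ, hM1ℓ⟩
  have hNK' : ∀ q ∈ (n * ℓ).primeFactors, Zhang2014.IsKolyvaginPrime (W.conductorNorm ℤ) W K 2 q ∧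
      M ≤ Zhang2014.kolyvaginIndex W 2 q :=
    fun q hq ↦ ⟨(hNK q hq).1, Nat.le_of_succ_le (hNK q hq).2⟩
  have hNKol : KolyvaginDescent.KolSupp (Zhang2014.IsKolyvaginPrime (W.conductorNorm ℤ) W K 2) (n * ℓ) :=
    ⟨hN, fun q hq ↦ (hNK q hq).1⟩
  have hNcard : (n * ℓ).primeFactors.card = n.primeFactors.card + 1 := by
    rw [hNpf, Finset.card_union_of_disjoint (Finset.disjoint_singleton_right.mpr hℓn),
      Finset.card_singleton]
  have hn''eq : n / a * ℓ * a = n * ℓ := by rw [mul_right_comm, Nat.div_mul_cancel han]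
  have ha'' : ¬ a ∣ n / a * ℓ := by
    intro h
    have : a * a ∣ n / a * ℓ * a := by
      rw [mul_comm (n / a * ℓ) a]; exact Nat.mul_dvd_mul_left a h
    rw [hn''eq] at this
    exact hap.one_lt.ne' (Nat.isUnit_iff.mp (hN a this))
  have hD : NumberField.discr K < -4 := IsImaginaryQuadratic.discr_lt_neg_four_of_odd hK hodd hne3
  obtain ⟨d', d'', hσ, hS, hS', hemb, hσ₁, hS₁, hS₁', hemb₁⟩ :=
    Summit.BirchSwinnertonDyer.Rank1Residual.JET.exists_compatible_data_triple_of_grossCM (W := W) hK hD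
      hHN 2 Dt β ι hn (fun q hq ↦ (hnK q hq).1) ha hKolℓ hℓn dat
  set C := d'.kolyvaginClass Nat.prime_two M with hC_def
  obtain ⟨-, hCsign⟩ := KolyvaginClassSign.sign_conjAct_kolyvaginClass_two hK hne3 hne4 hodd hHN hsur1 τ hτ1
    Dt β ι hN hM1 hNK' d'
  have hCsign' : conjAct W τ ((2 ^ M : ℕ) : ℤ) C = ε' • C := by
    rw [hC_def, hCsign, hNcard, hε'_def, hεn_def, pow_succ]; ring_nf
  have hCF : C ∈ (selmerF W ((2 ^ M : ℕ) : ℤ) (𝒯 M) (placesDividing K (n * ℓ))).selmerGroup := by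
    have h := zsmul_kolyvaginClass_mem_selmerF W Dt β ι 𝒯 (hK := hK) (hP4 := hP4) (hT2 := hT2) d' hNKol hM1
      (fun q hq ↦ (hNK q hq).2)
    rwa [pow_zero, Nat.cast_one, one_zsmul] at h
  obtain ⟨hv'v₀, hv₀m, hv'm, hv₀N, hv'N, hmc, hcov⟩ :=
    swapPlaces (K := K) hn ha hKola.2.2.2.2.1 hℓp hKolℓ.2.2.2.2.1 hℓn hv₀ hv'
  have hwKum : galoisCohomology.localization ((W.baseChange K).torsionGaloisModule ((2 ^ M : ℕ) : ℤ)) (Sum.inr v') 1 w ∈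
      (W.baseChange K).kummerSelmerStructure ((2 ^ M : ℕ) : ℤ) (Sum.inr v') := by
    have h := (SelmerStructure.mem_selmerGroup_iff _ w).mp hwF (Sum.inr v')
    rwa [relaxedAt_inr_of_ne W _ _ hv'v₀, selmerF_inr, if_neg hv'm] at h
  have hwa : ((2 ^ (u - 1) : ℕ) : ℤ) •
      galoisCohomology.localization ((W.baseChange K).torsionGaloisModule ((2 ^ M : ℕ) : ℤ)) (Sum.inr v') 1 w ≠ 0 := by
    intro h0
    have h1 : ((2 ^ (u - 1) : ℕ) : ℤ) • w ∈ (W.baseChange K).torsionLocalKer (v'.adicCompletion K) ((2 ^ M : ℕ) : ℤ) :=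
      (mem_torsionLocalKer_two_pow_iff W M v' _).mpr ((map_zsmul _ _ _).trans h0)
    have := (hwloc (u - 1)).mp h1
    omega
  have hcj : ((2 ^ (g - 1) : ℕ) : ℤ) • c ∉ (W.baseChange K).torsionLocalKer (v'.adicCompletion K) ((2 ^ M : ℕ) : ℤ) := by
    intro h; have := (hcloc (g - 1)).mp h; omega
  have hQℓ := hQ2 W hCM K hK hne3 hne4 hHN hsur Dt β ι M hM1 n ℓ hN hℓp hℓdvd hNK' dat d' hσ hS hS' hemb v' hv'
  have hCb : ((2 ^ (g - 1) : ℕ) : ℤ) •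
      galoisCohomology.localization ((W.baseChange K).torsionGaloisModule ((2 ^ M : ℕ) : ℤ)) (Sum.inr v') 1 C ∉
      (W.baseChange K).kummerSelmerStructure ((2 ^ M : ℕ) : ℤ) (Sum.inr v') := by
    intro h
    have h1 : ((2 ^ (g - 1) : ℕ) : ℤ) • C ∈ selmerLocalKer (W.baseChange K) (v'.adicCompletion K) ((2 ^ M : ℕ) : ℤ) :=
      (mem_selmerLocalKer_two_pow_iff W M v' _).mpr (mem_of_eq_of_mem_swap h (map_zsmul _ _ _))
    exact hcj ((hQℓ (g - 1)).2.mp ((hQℓ (g - 1)).1.mp h1))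
  have hCT : galoisCohomology.localization ((W.baseChange K).torsionGaloisModule ((2 ^ M : ℕ) : ℤ)) (Sum.inr v₀) 1 C ∈
      𝒯 M (Sum.inr v₀) :=
    ((mem_selmerGroup_selmerF_iff W _ (𝒯 M) hN0 _).mp hCF).2 v₀ hv₀N
  have hwuT : ((2 ^ u : ℕ) : ℤ) •
      galoisCohomology.localization ((W.baseChange K).torsionGaloisModule ((2 ^ M : ℕ) : ℤ)) (Sum.inr v₀) 1 w ∈ 𝒯 M (Sum.inr v₀) := by
    have : ((2 ^ u : ℕ) : ℤ) •
        galoisCohomology.localization ((W.baseChange K).torsionGaloisModule ((2 ^ M : ℕ) : ℤ)) (Sum.inr v₀) 1 w = 0 := by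
      rw [← map_zsmul, hu0, map_zero]
    rw [this]; exact zero_mem _
  have hkey : ((2 ^ (g - 1) : ℕ) : ℤ) • C ∉ (W.baseChange K).torsionLocalKer (v₀.adicCompletion K) ((2 ^ M : ℕ) : ℤ) := by
    intro hker
    have hb₀ : ((2 ^ (g - 1) : ℕ) : ℤ) •
        galoisCohomology.localization ((W.baseChange K).torsionGaloisModule ((2 ^ M : ℕ) : ℤ)) (Sum.inr v₀) 1 C = 0 :=
      (map_zsmul _ _ _).symm.trans ((mem_torsionLocalKer_two_pow_iff W M v₀ _).mp hker)
    have hB := hP7b M (M + k) a v₀ w C ε' u (g - 1) hε' hKola hidxa (by omega) haF hv₀ hwτ hCsign' hCT hwuT hb₀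
    have hA := hP7a M (M + k) ℓ v' w C ε' (u - 1) (g - 1) hε' hKolℓ hMℓ (by omega) hfrob hv' hwτ hCsign' hwKum hwa hCb
      (by omega)
    have hsum := localTatePairing_add_eq_zero_of_swap W 2 M (e M) (hμ M) (hadd₁ M) (hadd₂ M) (hgal M)
      (halt M) (hnondeg M) hK hM1 (inv M) (fun v ↦ ((hperf M) v).1.injective) (hvan M) (𝒯 M)
      (h𝒯sd M (n * ℓ)) hv'v₀.symm hcov hmc hv₀m hv₀N hv'N w C hwF hCF
    have hexp : u - 1 + (g - 1) - M = u + (g - 1) - M - 1 := by omega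
    rw [hexp] at hA
    have h3 := congrArg (fun x : ZMod (2 ^ M) ↦ (2 ^ (u + (g - 1) - M - 1) : ℕ) • x) hsum
    simp only [smul_add, smul_zero] at h3
    rw [hB, zero_add] at h3
    exact hA h3
  have hQa := kolyvaginRelationAtTwo_cast W Dt β ι (hCM := hCM) (hsur := hsur) (hK := hK) (hne3 := hne3)
    (hne4 := hne4) (hHN := hHN) (hQ2 := hQ2) M hM1 hn''eq hN hap ha'' hNK' d'' d' hσ₁ hS₁ hS₁' hemb₁ v₀ hv₀ (g - 1)
  have hkey'' : ((2 ^ (g - 1) : ℕ) : ℤ) • d''.kolyvaginClass Nat.prime_two M ∉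
      (W.baseChange K).torsionLocalKer (v₀.adicCompletion K) ((2 ^ M : ℕ) : ℤ) := fun h ↦ hkey (hQa.2.mpr h)
  have hne'' : ((2 ^ (g - 1) : ℕ) : ℤ) • d''.kolyvaginClass Nat.prime_two M ≠ 0 :=
    fun h ↦ hkey'' (by rw [h]; exact zero_mem _)
  refine ⟨ℓ, hℓX, hℓn, hKolℓ, hIℓ, hfrob, fun v hv ↦ ?_, d'', hne''⟩
  intro h
  have := ((hlocℓ v hv).1 (g - 1)).mp h
  omega

end Frame

end Summit.BirchSwinnertonDyer.BirchSwinnertonDyer.Theorems.GenusExact.PlusDescent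

end
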